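import Literature.Barriers.CriticalPhenomena.SubexponentialGrowthZdProofs
import Literature.Probability.Percolation.PercolationEvents
import Mathlib.Combinatorics.SimpleGraph.Metric
import Mathlib.Data.Finset.Sym
import HarnessLib

/-!
# The exploratory essential enhancement of Martineau–Severo (2019, §4): the cluster `𝒞_o(ω, α)` and the event `𝓔_L`

Third file of the inline proof of `Literature.Probability.Percolation.MartineauSevero2019_cor22`, on an
arbitrary (connected, locally finite) graph `H` — the quotient `ℋ` in the application. Martineau–Severo
(Ann. Probab. 47 (2019), §4) fix `r ≥ 1` and, for `(ω, α) ∈ {0,1}^{E(ℋ)} × {0,1}^{V(ℋ)}`, define `𝒞_o(ω,α)`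
by alternating steps: `C_{2n+1}` = union of the `ω`-clusters of `C_{2n}`; `C_{2n+2}` adds the vertices `v` with
`d(u,v) = r+1` for some `u ∈ C_{2n+1}` such that "`ω_e = 1` for all edges `e` in `B_r(u)`" and "`α_u = 1`";
`𝒞_o := ⋃_n C_n`, and more generally `𝒞_A` started from `C_0 = A`. We take the equivalent inductive closure
(`EnhReach`: seed / open edge / bonus) — the least set containing `A`, closed under `ω`-open edges and under the
bonus rule — which is the same set.

* `edgesInBall H u n` — the edges of `H` inside `B_n(u)` ("the edges in `B_r(u)`"), finite (`edgesInBallFin`).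
* `enhCluster H r A ω α` — `𝒞_A(ω, α)`; monotone in `(A, ω, α)` (`enhCluster_mono`); a fully open ball around a
  point of the cluster lies in the cluster (`graphBall_subset_enhCluster`).
* Coordinates `Sym2 W ⊕ W` for the pair `(ω, α)` (`enhOmega`, `enhAlpha`), and the event
  `enhEvent H r o L = 𝓔_L := {∃ v ∈ 𝒞_o(ω,α), dist(o,v) ≥ L}` (§6: `{𝒞_o ∩ S_L(o) ≠ ∅}`; with the bonus adding whole
  spheres around fully open balls the two agree, and the present form is monotone in `L` for free); it is
  increasing (`isUpperSet_enhEvent`) and LOCAL: determined by the finite window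
  `enhWindow = E(B_{L+r}(o)) ⊔ B_L(o)` (`determinedBy_enhEvent`), via the closure principle
  `exists_far_of_closed` (any set containing `o` and closed under the two rules applied at vertices of
  `B_{L-1}(o)` reaches distance `L` whenever `𝓔_L` holds) which is also the correctness statement of the
  exploration of the sequel files.

## References

* S. Martineau, F. Severo, Ann. Probab. 47 (2019), §4 (definition of `𝒞_o(ω,α)`, `𝒞_A`), §6 (`𝓔_L`, "depends
  only on finitely many coordinates, is increasing in both `ω` and `α`") [MartineauSevero2019].
* M. Aizenman, G. Grimmett, J. Stat. Phys. 63 (1991) (essential enhancements) [AizenmanGrimmett1991].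
-/

namespace Literature.Probability.Percolation

open Literature.Barriers.CriticalPhenomena

variable {W : Type*}

/-! ### Edges inside a ball -/

/-- The edges of `H` inside the ball `B_n(u)` (both endpoints in the ball): Martineau–Severo's "edges `e` in
`B_r(u)`". [cite: MartineauSevero2019, §4 (ω_e = 1 for all edges e in B_r(u))] -/
def edgesInBall (H : SimpleGraph W) (u : W) (n : ℕ) : Set (Sym2 W) :=
  H.edgeSet ∩ (graphBall H u n).sym2

/-- Membership in `edgesInBall` for an explicit pair. [folklore] -/
theorem mk_mem_edgesInBall_iff {H : SimpleGraph W} {u a b : W} {n : ℕ} :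
    s(a, b) ∈ edgesInBall H u n ↔ H.Adj a b ∧ a ∈ graphBall H u n ∧ b ∈ graphBall H u n := by
  simp [edgesInBall, Set.mk_mem_sym2_iff]

/-- `edgesInBall` grows with the radius. [folklore] -/
theorem edgesInBall_mono (H : SimpleGraph W) (u : W) {m n : ℕ} (h : m ≤ n) : edgesInBall H u m ⊆ edgesInBall H u n := by
  rintro e ⟨he, hb⟩
  refine ⟨he, ?_⟩
  induction e using Sym2.inductionOn with
  | hf a b => exact ⟨graphBall_mono H u h hb.1, graphBall_mono H u h hb.2⟩

/-- Edges inside a ball are edges. [folklore] -/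
theorem edgesInBall_subset_edgeSet (H : SimpleGraph W) (u : W) (n : ℕ) : edgesInBall H u n ⊆ H.edgeSet :=
  Set.inter_subset_left

/-- `edgesInBall` is finite for a locally finite graph. [folklore] -/
theorem edgesInBall_finite (H : SimpleGraph W) [H.LocallyFinite] (u : W) (n : ℕ) : (edgesInBall H u n).Finite := by
  refine Set.Finite.subset ?_ Set.inter_subset_right
  have : (graphBall H u n).sym2 = ↑((graphBall_finite H u n).toFinset.sym2) := by
    rw [Finset.coe_sym2, Set.Finite.coe_toFinset]
  rw [this]
  exact Finset.finite_toSet _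

/-- `edgesInBall` as a `Finset`. [folklore] -/
noncomputable def edgesInBallFin (H : SimpleGraph W) [H.LocallyFinite] (u : W) (n : ℕ) : Finset (Sym2 W) :=
  (edgesInBall_finite H u n).toFinset

/-- Membership in `edgesInBallFin`. [folklore] -/
@[simp] theorem mem_edgesInBallFin {H : SimpleGraph W} [H.LocallyFinite] {u : W} {n : ℕ} {e : Sym2 W} :
    e ∈ edgesInBallFin H u n ↔ e ∈ edgesInBall H u n :=
  Set.Finite.mem_toFinset _

/-- The ball of a locally finite graph as a `Finset`. [folklore] -/
noncomputable def ballFin (H : SimpleGraph W) [H.LocallyFinite] (u : W) (n : ℕ) : Finset W :=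
  (graphBall_finite H u n).toFinset

/-- Membership in `ballFin`. [folklore] -/
@[simp] theorem mem_ballFin {H : SimpleGraph W} [H.LocallyFinite] {u v : W} {n : ℕ} :
    v ∈ ballFin H u n ↔ v ∈ graphBall H u n :=
  Set.Finite.mem_toFinset _

/-- Reverse first-step decomposition of balls: a point of `B_{k+1}(u)` is `u` or a neighbour of a point of
`B_k(u)`. [folklore] -/
theorem mem_graphBall_succ_iff' (H : SimpleGraph W) (u v : W) (k : ℕ) :
    v ∈ graphBall H u (k + 1) ↔ v = u ∨ ∃ v', v' ∈ graphBall H u k ∧ H.Adj v' v := by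
  constructor
  · rintro ⟨w, hw⟩
    induction w using SimpleGraph.Walk.concatRec with
    | Hnil => exact Or.inl rfl
    | @Hconcat a b c p h _ =>
      rw [SimpleGraph.Walk.length_concat] at hw
      exact Or.inr ⟨b, ⟨p, by omega⟩, h⟩
  · rintro (rfl | ⟨v', ⟨w, hw⟩, hadj⟩)
    · exact mem_graphBall_self H v _
    · exact ⟨w.concat hadj, by rw [SimpleGraph.Walk.length_concat]; omega⟩

/-- In a connected graph, `edgesInBall H u n ⊆ edgesInBall H o (m + n)` when `dist(o,u) ≤ m`. [folklore] -/
theorem edgesInBall_subset_edgesInBall_of_dist_le {H : SimpleGraph W} (hH : H.Connected) {o u : W} {m n : ℕ}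
    (h : H.dist o u ≤ m) : edgesInBall H u n ⊆ edgesInBall H o (m + n) := by
  rintro e ⟨he, hb⟩
  refine ⟨he, ?_⟩
  have hu : u ∈ graphBall H o m := by
    obtain ⟨w, hw⟩ := hH.exists_walk_length_eq_dist o u
    exact ⟨w, hw ▸ h⟩
  induction e using Sym2.inductionOn with
  | hf a b =>
    exact ⟨by exact mem_graphBall_add' hu hb.1, by exact mem_graphBall_add' hu hb.2⟩
where
  /-- triangle inequality for balls (local copy) [folklore] -/
  mem_graphBall_add' {x y z : W} {m n : ℕ} (hy : y ∈ graphBall H x m) (hz : z ∈ graphBall H y n) :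
      z ∈ graphBall H x (m + n) := by
    obtain ⟨w₁, h₁⟩ := hy
    obtain ⟨w₂, h₂⟩ := hz
    exact ⟨w₁.append w₂, by rw [SimpleGraph.Walk.length_append]; omega⟩

/-! ### The enhanced cluster `𝒞_A(ω, α)` -/

/-- The inductive generation of Martineau–Severo's cluster `𝒞_A(ω,α)`: seeds, `ω`-open edges of `H`, and the
bonus — from `u` in the cluster with `α_u = 1` and all edges of `B_r(u)` open, every `v` with `d(u,v) = r+1`
joins. [cite: MartineauSevero2019, §4 (definition of 𝒞_o(ω,α) and 𝒞_A)] -/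
inductive EnhReach (H : SimpleGraph W) (r : ℕ) (A : Set W) (ω : Set (Sym2 W)) (α : Set W) : W → Prop
  | seed {v : W} : v ∈ A → EnhReach H r A ω α v
  | edge {u v : W} : EnhReach H r A ω α u → H.Adj u v → s(u, v) ∈ ω → EnhReach H r A ω α v
  | bonus {u v : W} : EnhReach H r A ω α u → u ∈ α → edgesInBall H u r ⊆ ω → H.dist u v = r + 1 →
      EnhReach H r A ω α v

/-- **The enhanced cluster `𝒞_A(ω, α)`** of the seed set `A` (Martineau–Severo's `𝒞_A`, `𝒞_o = 𝒞_{{o}}`).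
[cite: MartineauSevero2019, §4 (𝒞_o(ω,α), 𝒞_A)] -/
def enhCluster (H : SimpleGraph W) (r : ℕ) (A : Set W) (ω : Set (Sym2 W)) (α : Set W) : Set W :=
  {v | EnhReach H r A ω α v}

/-- Seeds lie in the cluster. [cite: MartineauSevero2019, §4 (C_0 = A)] -/
theorem subset_enhCluster (H : SimpleGraph W) (r : ℕ) (A : Set W) (ω : Set (Sym2 W)) (α : Set W) :
    A ⊆ enhCluster H r A ω α := fun _ hv => EnhReach.seed hv

/-- **Monotonicity** of `𝒞_A(ω,α)` in the seed set, the open edges and the marks.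
[cite: MartineauSevero2019, §6 ("increasing in both ω and α")] -/
theorem enhCluster_mono (H : SimpleGraph W) (r : ℕ) {A A' : Set W} {ω ω' : Set (Sym2 W)} {α α' : Set W}
    (hA : A ⊆ A') (hω : ω ⊆ ω') (hα : α ⊆ α') : enhCluster H r A ω α ⊆ enhCluster H r A' ω' α' := by
  intro v hv
  induction hv with
  | seed h => exact EnhReach.seed (hA h)
  | edge _ hadj he ih => exact EnhReach.edge ih hadj (hω he)
  | bonus _ hu hb hd ih => exact EnhReach.bonus ih (hα hu) (hb.trans hω) hd

/-- The edge rule. [cite: MartineauSevero2019, §4 (C_{2n+1})] -/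
theorem mem_enhCluster_of_adj {H : SimpleGraph W} {r : ℕ} {A : Set W} {ω : Set (Sym2 W)} {α : Set W}
    {u v : W} (hu : u ∈ enhCluster H r A ω α) (hadj : H.Adj u v) (he : s(u, v) ∈ ω) :
    v ∈ enhCluster H r A ω α :=
  EnhReach.edge hu hadj he

/-- The bonus rule. [cite: MartineauSevero2019, §4 (C_{2n+2})] -/
theorem mem_enhCluster_of_bonus {H : SimpleGraph W} {r : ℕ} {A : Set W} {ω : Set (Sym2 W)} {α : Set W}
    {u v : W} (hu : u ∈ enhCluster H r A ω α) (hα : u ∈ α) (hb : edgesInBall H u r ⊆ ω)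
    (hd : H.dist u v = r + 1) : v ∈ enhCluster H r A ω α :=
  EnhReach.bonus hu hα hb hd

/-- **Induction principle** for membership in `𝒞_A(ω,α)` (restating the constructors for a predicate on
vertices). [cite: MartineauSevero2019, §4] -/
theorem enhCluster_induction {H : SimpleGraph W} {r : ℕ} {A : Set W} {ω : Set (Sym2 W)} {α : Set W}
    {P : W → Prop} (hseed : ∀ v ∈ A, P v)
    (hedge : ∀ u v, u ∈ enhCluster H r A ω α → P u → H.Adj u v → s(u, v) ∈ ω → P v)
    (hbonus : ∀ u v, u ∈ enhCluster H r A ω α → P u → u ∈ α → edgesInBall H u r ⊆ ω → H.dist u v = r + 1 → P v)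
    {v : W} (hv : v ∈ enhCluster H r A ω α) : P v := by
  induction hv with
  | seed h => exact hseed _ h
  | edge hu hadj he ih => exact hedge _ _ hu ih hadj he
  | bonus hu hα hb hd ih => exact hbonus _ _ hu ih hα hb hd

/-- **A fully open ball around a cluster point lies in the cluster**: if `u ∈ 𝒞` and every edge of `B_n(u)` is
open then `B_n(u) ⊆ 𝒞` (walk inwards along the open edges). [cite: MartineauSevero2019, §6 ("B_r(z) is p-open … B_{r+1}(z) is contained in 𝒞_o")] -/
theorem graphBall_subset_enhCluster {H : SimpleGraph W} {r : ℕ} {A : Set W} {ω : Set (Sym2 W)} {α : Set W}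
    {u : W} {n : ℕ} (hu : u ∈ enhCluster H r A ω α) (hb : edgesInBall H u n ⊆ ω) :
    graphBall H u n ⊆ enhCluster H r A ω α := by
  suffices h : ∀ k, k ≤ n → graphBall H u k ⊆ enhCluster H r A ω α from h n le_rfl
  intro k
  induction k with
  | zero =>
    intro _ v hv
    rw [graphBall_zero] at hv
    rw [Set.mem_singleton_iff.1 hv]
    exact hu
  | succ k ih =>
    intro hk v hv
    rcases (mem_graphBall_succ_iff' H u v k).1 hv with rfl | ⟨v', hv', hadj⟩
    · exact hu
    · refine mem_enhCluster_of_adj (ih (Nat.le_of_succ_le hk) hv') hadj (hb ⟨hadj, ?_⟩)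
      exact ⟨graphBall_mono H u (Nat.le_of_succ_le hk) hv', graphBall_mono H u hk hv⟩

/-! ### Coordinates `(ω, α)` and the event `𝓔_L` -/

/-- The open edges `ω` of a joint configuration `ξ ⊆ E ⊔ V`. [cite: MartineauSevero2019, §4 ((ω, α))] -/
def enhOmega (ξ : Set (Sym2 W ⊕ W)) : Set (Sym2 W) := Sum.inl ⁻¹' ξ

/-- The marked vertices `α` of a joint configuration `ξ ⊆ E ⊔ V`. [cite: MartineauSevero2019, §4 ((ω, α))] -/
def enhAlpha (ξ : Set (Sym2 W ⊕ W)) : Set W := Sum.inr ⁻¹' ξ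

/-- Unfolding `enhOmega`. [folklore] -/
@[simp] theorem mem_enhOmega {ξ : Set (Sym2 W ⊕ W)} {e : Sym2 W} : e ∈ enhOmega ξ ↔ Sum.inl e ∈ ξ := Iff.rfl

/-- Unfolding `enhAlpha`. [folklore] -/
@[simp] theorem mem_enhAlpha {ξ : Set (Sym2 W ⊕ W)} {v : W} : v ∈ enhAlpha ξ ↔ Sum.inr v ∈ ξ := Iff.rfl

/-- `enhOmega` is monotone. [folklore] -/
theorem enhOmega_mono {ξ ξ' : Set (Sym2 W ⊕ W)} (h : ξ ⊆ ξ') : enhOmega ξ ⊆ enhOmega ξ' := fun _ he => h he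

/-- `enhAlpha` is monotone. [folklore] -/
theorem enhAlpha_mono {ξ ξ' : Set (Sym2 W ⊕ W)} (h : ξ ⊆ ξ') : enhAlpha ξ ⊆ enhAlpha ξ' := fun _ he => h he

/-- **The event `𝓔_L`**: the enhanced cluster of `o` contains a vertex at distance `≥ L` from `o`
(equivalently meets the sphere `S_L(o)`; Martineau–Severo, §6). [cite: MartineauSevero2019, §6 (𝓔_L)] -/
def enhEvent (H : SimpleGraph W) (r : ℕ) (o : W) (L : ℕ) : Set (Set (Sym2 W ⊕ W)) :=
  {ξ | ∃ v, v ∈ enhCluster H r {o} (enhOmega ξ) (enhAlpha ξ) ∧ L ≤ H.dist o v}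

/-- `𝓔_L` is increasing in `(ω, α)`. [cite: MartineauSevero2019, §6 ("increasing in both ω and α")] -/
theorem isUpperSet_enhEvent (H : SimpleGraph W) (r : ℕ) (o : W) (L : ℕ) : IsUpperSet (enhEvent H r o L) := by
  rintro ξ ξ' hle ⟨v, hv, hd⟩
  exact ⟨v, enhCluster_mono H r subset_rfl (enhOmega_mono hle) (enhAlpha_mono hle) hv, hd⟩

/-- `𝓔_L` is decreasing in `L`. [folklore] -/
theorem enhEvent_antitone (H : SimpleGraph W) (r : ℕ) (o : W) {L L' : ℕ} (h : L ≤ L') :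
    enhEvent H r o L' ⊆ enhEvent H r o L := by
  rintro ξ ⟨v, hv, hd⟩
  exact ⟨v, hv, h.trans hd⟩

/-! ### The closure principle and locality -/

/-- **Closure principle.** Let `S ∋ o` be closed under the two generating rules applied at vertices `u ∈ S`
with `dist(o,u) < L` (open edge from `u`; bonus at `u`). If `𝓔_L` holds for `(ω, α)` then `S` contains a
vertex at distance `≥ L`: follow the generation of a far vertex of `𝒞_o` and stop the first time distance
`≥ L` is reached — all earlier steps are taken from vertices at distance `< L`.
[cite: MartineauSevero2019, §5–§6 (the exploration computes 𝒞_o; 𝓔_L is local)] -/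
theorem exists_far_of_closed {H : SimpleGraph W} {r : ℕ} {o : W} {L : ℕ} {ω : Set (Sym2 W)} {α : Set W}
    (S : Set W) (ho : o ∈ S)
    (hedge : ∀ u v, u ∈ S → H.dist o u < L → H.Adj u v → s(u, v) ∈ ω → v ∈ S)
    (hbonus : ∀ u v, u ∈ S → H.dist o u < L → u ∈ α → edgesInBall H u r ⊆ ω → H.dist u v = r + 1 → v ∈ S)
    (hfar : ∃ v, v ∈ enhCluster H r {o} ω α ∧ L ≤ H.dist o v) : ∃ v ∈ S, L ≤ H.dist o v := by
  obtain ⟨v, hv, hLv⟩ := hfar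
  -- Q(v): either v ∈ S with dist < L, or S already reaches distance L
  have key : ∀ v, v ∈ enhCluster H r {o} ω α → (v ∈ S ∧ H.dist o v < L) ∨ ∃ v' ∈ S, L ≤ H.dist o v' := by
    intro v hv
    refine enhCluster_induction (P := fun v => (v ∈ S ∧ H.dist o v < L) ∨ ∃ v' ∈ S, L ≤ H.dist o v')
      ?_ ?_ ?_ hv
    · intro w hw
      rw [Set.mem_singleton_iff] at hw
      subst hw
      by_cases hL : H.dist w w < L
      · exact Or.inl ⟨ho, hL⟩
      · exact Or.inr ⟨w, ho, not_lt.1 hL⟩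
    · rintro u w - (⟨huS, hud⟩ | hfar) hadj he
      · have hw : w ∈ S := hedge u w huS hud hadj he
        by_cases hL : H.dist o w < L
        · exact Or.inl ⟨hw, hL⟩
        · exact Or.inr ⟨w, hw, not_lt.1 hL⟩
      · exact Or.inr hfar
    · rintro u w - (⟨huS, hud⟩ | hfar) hα hb hd
      · have hw : w ∈ S := hbonus u w huS hud hα hb hd
        by_cases hL : H.dist o w < L
        · exact Or.inl ⟨hw, hL⟩
        · exact Or.inr ⟨w, hw, not_lt.1 hL⟩
      · exact Or.inr hfar
  rcases key v hv with ⟨-, hlt⟩ | h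
  · exact absurd hLv (not_le.2 hlt)
  · exact h

/-- **Locality of `𝓔_L`.** `𝓔_L` is determined by the edges inside `B_{L+r}(o)` and the marks inside `B_L(o)`
(as subsets of the coordinate type `E ⊔ V`). [cite: MartineauSevero2019, §6 ("𝓔_L, which depends only on finitely many coordinates")] -/
theorem determinedBy_enhEvent {H : SimpleGraph W} (hH : H.Connected) (r : ℕ) (o : W) (L : ℕ)
    (K : Set (Sym2 W ⊕ W)) (hKe : Sum.inl '' edgesInBall H o (L + r) ⊆ K) (hKv : Sum.inr '' graphBall H o L ⊆ K) :
    DeterminedBy (enhEvent H r o L) K := by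
  -- it suffices to transport 𝓔_L from ξ to any ξ' agreeing with ξ on K
  suffices h : ∀ ξ ξ' : Set (Sym2 W ⊕ W), ξ ∩ K = ξ' ∩ K → ξ ∈ enhEvent H r o L → ξ' ∈ enhEvent H r o L by
    rw [determinedBy_iff]
    intro ξ ξ' hK
    exact ⟨h ξ ξ' hK, h ξ' ξ hK.symm⟩
  intro ξ ξ' hK hξ
  have hagree : ∀ i ∈ K, i ∈ ξ → i ∈ ξ' := fun i hi hiξ =>
    ((Set.ext_iff.1 hK i).1 ⟨hiξ, hi⟩).1
  have hdist : ∀ {u : W}, H.dist o u < L → u ∈ graphBall H o L := fun {u} hu => by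
    obtain ⟨w, hw⟩ := hH.exists_walk_length_eq_dist o u
    exact ⟨w, by omega⟩
  refine exists_far_of_closed (ω := enhOmega ξ) (α := enhAlpha ξ)
    (enhCluster H r {o} (enhOmega ξ') (enhAlpha ξ')) (subset_enhCluster _ _ _ _ _ rfl) ?_ ?_ hξ
  · intro u w hu hud hadj he
    refine mem_enhCluster_of_adj hu hadj (hagree _ (hKe ⟨s(u, w), ?_, rfl⟩) he)
    refine ⟨hadj, ?_⟩
    have huL : u ∈ graphBall H o (L + r) := graphBall_mono H o (Nat.le_add_right L r) (hdist hud)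
    refine ⟨huL, ?_⟩
    have : w ∈ graphBall H o (L + r) := by
      obtain ⟨p, hp⟩ := hH.exists_walk_length_eq_dist o u
      exact ⟨p.concat hadj, by rw [SimpleGraph.Walk.length_concat]; omega⟩
    exact this
  · intro u w hu hud hα hb hd
    refine mem_enhCluster_of_bonus hu (hagree _ (hKv ⟨u, hdist hud, rfl⟩) hα) (fun e he => ?_) hd
    exact hagree _ (hKe ⟨e, edgesInBall_subset_edgesInBall_of_dist_le hH hud.le he, rfl⟩) (hb he)

/-- The finite **window** of coordinates `E(B_{L+r}(o)) ⊔ B_L(o)` determining `𝓔_L`.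
[cite: MartineauSevero2019, §6 (finitely many coordinates)] -/
noncomputable def enhWindow (H : SimpleGraph W) [H.LocallyFinite] (r : ℕ) (o : W) (L : ℕ) : Finset (Sym2 W ⊕ W) :=
  (edgesInBallFin H o (L + r)).disjSum (ballFin H o L)

/-- Membership of an edge coordinate in the window. [folklore] -/
@[simp] theorem inl_mem_enhWindow {H : SimpleGraph W} [H.LocallyFinite] {r : ℕ} {o : W} {L : ℕ} {e : Sym2 W} :
    (Sum.inl e : Sym2 W ⊕ W) ∈ enhWindow H r o L ↔ e ∈ edgesInBall H o (L + r) := by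
  simp [enhWindow]

/-- Membership of a vertex coordinate in the window. [folklore] -/
@[simp] theorem inr_mem_enhWindow {H : SimpleGraph W} [H.LocallyFinite] {r : ℕ} {o : W} {L : ℕ} {v : W} :
    (Sum.inr v : Sym2 W ⊕ W) ∈ enhWindow H r o L ↔ v ∈ graphBall H o L := by
  simp [enhWindow]

/-- **`𝓔_L` is determined by the window.** [cite: MartineauSevero2019, §6] -/
theorem determinedBy_enhEvent_enhWindow {H : SimpleGraph W} [H.LocallyFinite] (hH : H.Connected) (r : ℕ)
    (o : W) (L : ℕ) : DeterminedBy (enhEvent H r o L) ↑(enhWindow H r o L) := by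
  refine determinedBy_enhEvent hH r o L _ ?_ ?_
  · rintro _ ⟨e, he, rfl⟩
    exact Finset.mem_coe.2 (inl_mem_enhWindow.2 he)
  · rintro _ ⟨v, hv, rfl⟩
    exact Finset.mem_coe.2 (inr_mem_enhWindow.2 hv)

end Literature.Probability.Percolation
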